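import Summits.CriticalPhenomena.PercolationContinuityZ3.Theorems.PercAnnulusCrossingBoxCrossingEasy
import HarnessLib

/-!
# RSW3 lane: Kesten's length monotonicity of box crossings — a LONGER block is harder to cross

builds on p205010 (kernel theorem, internal audit signed; external expert review pending)

Cell `prim-rsw3`, lead seat.  Kesten 1982 §3.3 Comment (v): the crossing probability `σ(n̄; i, p)` of the
block `[0,n_1] × ⋯ × [0,n_d]` is DECREASING in the length `n_i` and increasing in the other sides.  The second
half is `Crossing.boxCross_mono` (p208436, pointwise).  The first half is NOT a pointwise inclusion of events for
arbitrary configurations `ω ⊆ Sym2 ℤ^d` (a non-lattice "edge" could jump over the plane `{x_i = L_i}`); it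
holds on lattice configurations `ω ⊆ E(ℤ^d)`, which carry the Bernoulli measure, hence for probabilities:

* `exists_reach_plane_of_walk` — an open lattice walk inside the block `Icc 0 L'` from `{x_i < L_i}` to
  `{x_i ≥ L_i}` passes through the plane `{x_i = L_i}`; its initial segment is an induced open path of the
  shorter block;
* `boxCross_anti_length_of_subset_edgeSet` — for `ω ⊆ E(ℤ^d)`: `ω ∈ boxCross L' i → ω ∈ boxCross L i`
  whenever `0 ≤ L_i ≤ L'_i` and `L_j = L'_j` (`j ≠ i`);
* `real_boxCross_anti_length`, `real_boxCross_anti` — `P_p(boxCross L' i) ≤ P_p(boxCross L i)` for a longer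
  (and possibly narrower) block `L'`: the full Comment (v).
[cite: Kesten1982, §3.3 Comment (v)]
-/

noncomputable section

namespace Summit.CriticalPhenomena.PercolationContinuityZ3.Theorems.Crossing

open MeasureTheory Literature.Probability.LatticeModels Literature.Probability.Percolation
open Summit.CriticalPhenomena.PercolationContinuityZ3.Theorems.SurfaceTension

variable {d : ℕ}

/-- Along a lattice edge every coordinate moves by at most one (upwards). [folklore] -/
theorem apply_le_add_one_of_zdGraph_adj {a b : Site d} (h : (zdGraph d).Adj a b) (i : Fin d) :
    b i ≤ a i + 1 := by
  rw [zdGraph_adj_iff] at h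
  obtain ⟨j, hj | hj⟩ := h
  · rw [hj, Pi.add_apply]
    rcases eq_or_ne i j with rfl | hij
    · rw [Pi.single_eq_same]
    · rw [Pi.single_eq_of_ne hij]; linarith
  · rw [hj, Pi.add_apply]
    rcases eq_or_ne i j with rfl | hij
    · rw [Pi.single_eq_same]; linarith
    · rw [Pi.single_eq_of_ne hij]; linarith

/-- **First passage through a coordinate plane.**  On a lattice configuration `ω ⊆ E(ℤ^d)`, an open walk of the
graph induced on `S'`, from `u` with `u_i < c` to `v` with `c ≤ v_i`, reaches a vertex `z` with `z_i = c` by an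
initial segment all of whose vertices `w` satisfy `w_i ≤ c`; the conclusion is reachability in the open graph induced
on any `T ⊇ {w ∈ S' | w_i ≤ c}`. [folklore] -/
theorem exists_reach_plane_of_walk {ω : BondConfig (Site d)} (hω : ω ⊆ (zdGraph d).edgeSet)
    (S' T : Set (Site d)) (i : Fin d) (c : ℤ) (hT : ∀ w ∈ S', w i ≤ c → w ∈ T) :
    ∀ {u v : S'} (_ : ((openGraph ω).induce S').Walk u v), (u : Site d) i < c → c ≤ (v : Site d) i →
      ∃ (z : Site d) (hu : (u : Site d) ∈ T) (hz : z ∈ T), z i = c ∧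
        ((openGraph ω).induce T).Reachable ⟨u, hu⟩ ⟨z, hz⟩
  | u, _, SimpleGraph.Walk.nil, hu, hv => absurd hv (not_le.2 hu)
  | u, v, SimpleGraph.Walk.cons (v := u₁) h W', hu, hv => by
      have hadj : (openGraph ω).Adj (u : Site d) (u₁ : Site d) := by
        simpa [SimpleGraph.comap_adj] using h
      have huT : (u : Site d) ∈ T := hT u u.2 hu.le
      have hstep : (u₁ : Site d) i ≤ (u : Site d) i + 1 :=
        apply_le_add_one_of_zdGraph_adj (DCT16.adj_of_openGraph_adj hω hadj) i
      by_cases h₁ : (u₁ : Site d) i < c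
      · obtain ⟨z, hu₁T, hzT, hzi, hreach⟩ := exists_reach_plane_of_walk hω S' T i c hT W' h₁ hv
        refine ⟨z, huT, hzT, hzi, SimpleGraph.Reachable.trans (SimpleGraph.Adj.reachable ?_) hreach⟩
        simpa [SimpleGraph.comap_adj] using hadj
      · have hu₁i : (u₁ : Site d) i = c := le_antisymm (by omega) (not_lt.1 h₁)
        have hu₁T : (u₁ : Site d) ∈ T := hT u₁ u₁.2 hu₁i.le
        refine ⟨u₁, huT, hu₁T, hu₁i, SimpleGraph.Adj.reachable ?_⟩
        simpa [SimpleGraph.comap_adj] using hadj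

/-- **Length monotonicity on lattice configurations.**  For `ω ⊆ E(ℤ^d)`, a crossing of the longer block
`Icc 0 L'` in direction `i` yields a crossing of the shorter block `Icc 0 L` (`0 ≤ L_i ≤ L'_i`, equal transverse
sides): cut the crossing at its first passage through `{x_i = L_i}`. [cite: Kesten1982, §3.3 Comment (v)] -/
theorem boxCross_anti_length_of_subset_edgeSet {ω : BondConfig (Site d)} (hω : ω ⊆ (zdGraph d).edgeSet)
    {L L' : Site d} {i : Fin d} (h0 : 0 ≤ L i) (hi : L i ≤ L' i) (hj : ∀ j, j ≠ i → L j = L' j)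
    (hmem : ω ∈ boxCross L' i) : ω ∈ boxCross L i := by
  obtain ⟨x, hx, y, hy, hx0, hyL, hxS, hyS, hreach⟩ := hmem
  -- membership transfer: a point of the long block with `w_i ≤ L_i` lies in the short block
  have hT : ∀ w ∈ (↑(Finset.Icc (0 : Site d) L') : Set (Site d)), w i ≤ L i →
      w ∈ (↑(Finset.Icc (0 : Site d) L) : Set (Site d)) := by
    intro w hw hwi
    rw [Finset.coe_Icc, Set.mem_Icc] at hw ⊢
    refine ⟨hw.1, fun j => ?_⟩
    by_cases hji : j = i
    · subst hji; exact hwi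
    · rw [hj j hji]; exact hw.2 j
  rcases eq_or_lt_of_le h0 with hLi | hLi
  · -- degenerate length `L_i = 0`: `x` itself is on both faces
    have hxT : x ∈ (↑(Finset.Icc (0 : Site d) L) : Set (Site d)) := hT x (Finset.mem_coe.2 hx) (by rw [hx0, hLi])
    exact ⟨x, Finset.mem_coe.1 hxT, x, Finset.mem_coe.1 hxT, hx0, by rw [hx0, hLi], hxT, hxT,
      SimpleGraph.Reachable.refl _⟩
  · obtain ⟨W⟩ := hreach
    have hxlt : x i < L i := by rw [hx0]; exact hLi
    have hyge : L i ≤ y i := by rw [hyL]; exact hi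
    obtain ⟨z, hxT, hzT, hzi, hr⟩ :=
      exists_reach_plane_of_walk hω _ _ i (L i) hT W hxlt hyge
    exact ⟨x, Finset.mem_coe.1 hxT, z, Finset.mem_coe.1 hzT, hx0, hzi, hxT, hzT, hr⟩

/-- **Kesten's Comment (v), length half, for probabilities:** a longer block (same cross-section) is crossed
with no larger probability. [cite: Kesten1982, §3.3 Comment (v)] -/
theorem real_boxCross_anti_length (p : unitInterval) {L L' : Site d} {i : Fin d} (h0 : 0 ≤ L i)
    (hi : L i ≤ L' i) (hj : ∀ j, j ≠ i → L j = L' j) :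
    (bondPercolation (zdGraph d) p).real (boxCross L' i) ≤ (bondPercolation (zdGraph d) p).real (boxCross L i) :=
  DCT16.real_mono_of_forall_subset_edgeSet (zdGraph d) p fun _ hω h =>
    boxCross_anti_length_of_subset_edgeSet hω h0 hi hj h

/-- **Kesten's Comment (v), both halves:** if `L'` is at least as long as `L` in direction `i` and at most as wide
in every other direction, then `P_p(boxCross L' i) ≤ P_p(boxCross L i)`. [cite: Kesten1982, §3.3 Comment (v)] -/
theorem real_boxCross_anti (p : unitInterval) {L L' : Site d} {i : Fin d} (h0 : 0 ≤ L i)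
    (hi : L i ≤ L' i) (hj : ∀ j, j ≠ i → L' j ≤ L j) :
    (bondPercolation (zdGraph d) p).real (boxCross L' i) ≤ (bondPercolation (zdGraph d) p).real (boxCross L i) := by
  -- intermediate block: length `L'_i`, cross-section of `L`
  set M : Site d := fun j => if j = i then L' j else L j with hM
  have h1 : (bondPercolation (zdGraph d) p).real (boxCross L' i) ≤
      (bondPercolation (zdGraph d) p).real (boxCross M i) := by
    refine measureReal_mono (boxCross_mono (fun j => ?_) ?_)
    · by_cases hji : j = i
      · subst hji; simp [hM]
      · simp only [hM, hji, if_false]; exact hj j hji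
    · simp [hM]
  refine h1.trans (real_boxCross_anti_length p h0 (by simp [hM, hi]) fun j hji => ?_)
  simp [hM, hji]

/-! ## `EasyCrossingLowerBound 2` -/

/-- **Brick-to-block transfer.**  If p2's near-cube `r : (r+2)` of mesh `u` (length `r u`, width `(r+2) u`) is
at least as LONG and at most as WIDE as the block `(n, w, w)` of `ℤ³` (`n ≤ r u`, `(r+2) u ≤ w`), then
`85^{-3}/(3 (4r+5)^3) ≤ P_{p_c(ℤ³)}(boxCross ![n, w, w] 0)` (p207738 + `slabCrossing_negUnit_subset_boxCross` +
`real_boxCross_anti`). [cite: Kesten1982, §3.3 Comment (v) and Thm. 5.1] -/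
theorem le_boxCrossProb_of_brick {r u n w : ℕ} (hr : 1 ≤ r) (hu : 1 ≤ u) (hlen : n ≤ r * u)
    (hwid : (r + 2) * u ≤ w) :
    ((85 : ℝ) ^ 3)⁻¹ / (3 * (4 * r + 5) ^ 3) ≤
      (bondPercolation (zdGraph 3) (criticalProbI 3)).real (boxCross ![(n : ℤ), w, w] 0) := by
  have h := Rsw3.le_real_slabCrossing_criticalProbI (d := 3) (by norm_num) hu hr 0
    (fun j => if j = (0 : Fin 3) then (-1 : ℤ) else 0)
  have h₁ : ((85 : ℝ) ^ 3)⁻¹ / (3 * (4 * r + 5) ^ 3) ≤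
      (bondPercolation (zdGraph 3) (criticalProbI 3)).real
        (slabCrossing u r 0 (fun j => if j = (0 : Fin 3) then (-1 : ℤ) else 0)) := by
    simpa using h
  have h' := h₁.trans (measureReal_mono (slabCrossing_negUnit_subset_boxCross u r 0))
  refine h'.trans (real_boxCross_anti _ ?_ ?_ ?_)
  · simp
  · simp; exact_mod_cast hlen
  · intro j hj
    fin_cases j
    · exact absurd rfl hj
    · simp; exact_mod_cast hwid
    · simp; exact_mod_cast hwid

/-- A single open edge along the axis crosses the block of length `1`: `p ≤ P_p(boxCross ![1, w, w] 0)`.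
[folklore] -/
theorem le_real_boxCross_length_one (p : unitInterval) (w : ℕ) :
    (p : ℝ) ≤ (bondPercolation (zdGraph 3) p).real (boxCross ![(1 : ℤ), w, w] 0) := by
  set e₀ : Site 3 := Pi.single 0 1 with he₀
  have hadj : (zdGraph 3).Adj 0 e₀ := by rw [zdGraph_adj_iff]; exact ⟨0, Or.inl (by simp [he₀])⟩
  have hF : (↑({s((0 : Site 3), e₀)} : Finset (Sym2 (Site 3))) : Set (Sym2 (Site 3))) ⊆ (zdGraph 3).edgeSet := by
    intro e he
    rw [Finset.coe_singleton, Set.mem_singleton_iff] at he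
    rw [he, SimpleGraph.mem_edgeSet]; exact hadj
  have hp : (bondPercolation (zdGraph 3) p).real {ω | (↑({s((0 : Site 3), e₀)} : Finset _) : Set _) ⊆ ω} = p := by
    rw [bondPercolation_real_setOf_subset _ p _ hF, Finset.card_singleton, pow_one]
  rw [← hp]
  refine measureReal_mono fun ω hω => ?_
  have he : s((0 : Site 3), e₀) ∈ ω := hω (by simp)
  have h0 : (0 : Site 3) ∈ Finset.Icc (0 : Site 3) ![(1 : ℤ), w, w] := by
    rw [Finset.mem_Icc]; refine ⟨le_rfl, fun j => ?_⟩; fin_cases j <;> simp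
  have h1 : e₀ ∈ Finset.Icc (0 : Site 3) ![(1 : ℤ), w, w] := by
    rw [Finset.mem_Icc]; refine ⟨fun j => ?_, fun j => ?_⟩ <;> fin_cases j <;> simp [he₀]
  refine ⟨0, h0, e₀, h1, rfl, by simp [he₀], Finset.mem_coe.2 h0, Finset.mem_coe.2 h1,
    SimpleGraph.Adj.reachable ?_⟩
  simp only [SimpleGraph.comap_adj, Function.Embedding.subtype_apply, openGraph_adj]
  exact ⟨he, hadj.ne⟩

/-- **`Crossing.EasyCrossingLowerBound 2`:** at `p_c(ℤ³)` the blocks `{0..n} × {0..2n}²` are crossed the short way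
with probability `≥ 85^{-3}/(3·21³)` for every `n ≥ 1`.  Cases: `n = 1` (one edge, `p_c ≥ 1/6`), `n ∈ {2, 4}`
(near-cube `r = 2`, `u = n/2`, exact fit), `n = 7` (`r = 4`, `u = 2`), all other `n ≥ 3` (`r = 3`, `u = ⌊(n+2)/3⌋`:
`3u ≥ n` and `5u ≤ 2n`), each via `le_boxCrossProb_of_brick`. [cite: Kesten1982, (3.65), Thm. 5.1 and Comment 3.3 (v)] -/
theorem easyCrossingLowerBound_two : EasyCrossingLowerBound 2 := by
  have hc4 : (0 : ℝ) < ((85 : ℝ) ^ 3)⁻¹ / (3 * (4 * 4 + 5) ^ 3) := by positivity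
  refine ⟨((85 : ℝ) ^ 3)⁻¹ / (3 * (4 * 4 + 5) ^ 3), hc4, fun n hn => ?_⟩
  have hmono : ∀ r : ℕ, r ≤ 4 → ((85 : ℝ) ^ 3)⁻¹ / (3 * (4 * 4 + 5) ^ 3) ≤ ((85 : ℝ) ^ 3)⁻¹ / (3 * (4 * r + 5) ^ 3) := by
    intro r hr
    apply div_le_div_of_nonneg_left (by positivity) (by positivity)
    have : (4 * (r : ℝ) + 5) ≤ 4 * 4 + 5 := by
      have : (r : ℝ) ≤ 4 := by exact_mod_cast hr
      linarith
    have h0 : (0 : ℝ) ≤ 4 * (r : ℝ) + 5 := by positivity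
    nlinarith [pow_le_pow_left₀ h0 this 3]
  have hshape : boxCross (easyShape 2 n) 0 = boxCross ![(n : ℤ), (2 * n : ℕ), (2 * n : ℕ)] 0 := by
    simp only [easyShape]; push_cast; rfl
  rw [hshape]
  rcases Nat.lt_or_ge n 3 with hlt | hge
  · interval_cases n
    · -- n = 1: one edge
      refine le_trans ?_ (le_real_boxCross_length_one (criticalProbI 3) (2 * 1))
      rw [coe_criticalProbI]
      refine le_trans ?_ (criticalProb_zd_ge 3 (by norm_num))
      norm_num
    · exact (hmono 2 (by norm_num)).trans (le_boxCrossProb_of_brick (r := 2) (u := 1) (by norm_num) le_rfl (by norm_num) (by norm_num))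
  · by_cases h4 : n = 4
    · subst h4
      exact (hmono 2 (by norm_num)).trans (le_boxCrossProb_of_brick (r := 2) (u := 2) (by norm_num) (by norm_num) (by norm_num) (by norm_num))
    by_cases h7 : n = 7
    · subst h7
      exact (hmono 4 le_rfl).trans (le_boxCrossProb_of_brick (r := 4) (u := 2) (by norm_num) (by norm_num) (by norm_num) (by norm_num))
    · refine (hmono 3 (by norm_num)).trans
        (le_boxCrossProb_of_brick (r := 3) (u := (n + 2) / 3) (by norm_num) (by omega) (by omega) (by omega))

end Summit.CriticalPhenomena.PercolationContinuityZ3.Theorems.Crossing
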